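import Summits.ResolutionOfSingularities.ResolutionOfSingularities.Theorems.EquisingularLiftEquisingularLiftNatResidualCut
import Literature.AlgebraicGeometry.Resolution.AlterationsNormalFormStrictTransform
import Literature.AlgebraicGeometry.Resolution.SmoothStalksRegular
import Mathlib.AlgebraicGeometry.Morphisms.Smooth
import HarnessLib

/-!
# [OURS · L1 W4.5(b) · EL♮] SMOOTH MODEL END: a smooth `O`-model with special-fibre set `closure S′` makes `V(closure S′)_red` regular
# (the one geometric input of the strategist's T-PERM transfer, PROVED — any scheme, any `n`)
# (crux `EquisingularLiftNat` = stmt-ResolutionOfSingularities-20038; upstairs / lifted-model frame, parent-side host rung)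

HONEST FRAMING. OURS (cell res-hironaka, crux chain w45b, slot W4.5(b)); NOT a statement of any manuscript; replaces the role
of NOTHING in the manuscript; AI-written, AI review is weaker than expert review. Helper `--supports
stmt-ResolutionOfSingularities-20038 --as helper`. Discharges the named input `SmoothModelEnd` of res-L1-w45b-strat-1's T-PERM sketch
(STRATEGY-CENSUS v5, `Sketch-perm.lean` f2833a921cca68b2: `permTransfer : SmoothModelEnd → PermELNat → EquisingularLiftNat`), so the
upstairs transfer becomes unconditional.

WHAT. Over a local ring `O`: if a closed subscheme `V(D′) ⊆ P′` is SMOOTH over `Spec O` and its special-fibre SET is `closure S′`, then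
the reduced closed subscheme `V(closure S′)_red` of `P′` is REGULAR. Proof: the special fibre `V(D′) ×_O κ(O)` is smooth over the
field `κ(O)`, hence regular (Stacks 056S, tree `isRegularLocalRing_stalk_of_smooth_of_field`), and it is a closed subscheme of `P′`
with support `supp D′ ∩ q′⁻¹{𝔪} = closure S′`; a closed immersion from a regular scheme identifies it with the reduced closed
subscheme on its image (tree `isRegular_subscheme_vanishingIdeal_range`).

* `range_specMap_residue` — the image of `Spec κ(O) → Spec O` is the closed point;
* `range_fst_comp_subschemeι_eq` — the special fibre of `V(D′)`, as a closed subscheme of `P′`, has support `supp D′ ∩ q′⁻¹{𝔪}`;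
* `isRegular_specialFibre_of_smooth` — the special fibre of a smooth `V(D′) → Spec O` is a regular scheme;
* `smoothModelEnd` — THE OBJECT (the text of strat-1's `SmoothModelEnd`, now a theorem).

References: Stacks 056S; tree `Literature…SmoothStalksRegular`, `Literature…AlterationsNormalFormStrictTransform`
(`isRegular_subscheme_vanishingIdeal_range`), Mathlib `Scheme.Pullback.range_fst`.
-/

set_option linter.dupNamespace false -- mandated namespace `Summit.<Summit>.<Problem>` of this single-conjunct summit

universe u

open CategoryTheory CategoryTheory.Limits AlgebraicGeometry TopologicalSpace Topology
open Literature.AlgebraicGeometry.Resolution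
open AlgebraicGeometry.Scheme.IdealSheafData

namespace Summit.ResolutionOfSingularities.ResolutionOfSingularities.Cruxes.EquisingularLiftNat.PermFrame

/-! ## The special fibre of `V(D′)` as a closed subscheme of `P′` -/

/-- The image of `Spec κ(O) → Spec O` (residue field of a local ring) is the closed point. [folklore] -/
theorem range_specMap_residue (O : Type u) [CommRing O] [IsLocalRing O] :
    Set.range (Spec.map (CommRingCat.ofHom (IsLocalRing.residue O))) = {IsLocalRing.closedPoint O} := by
  have hpt : ∀ z : Spec (.of (IsLocalRing.ResidueField O)),
      Spec.map (CommRingCat.ofHom (IsLocalRing.residue O)) z = IsLocalRing.closedPoint O := by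
    intro z
    rw [Spec.map_apply]
    apply PrimeSpectrum.ext
    rw [PrimeSpectrum.comap_asIdeal, CommRingCat.hom_ofHom, Ideal.eq_bot_of_prime z.asIdeal,
      ← RingHom.ker_eq_comap_bot, IsLocalRing.ker_residue]
    rfl
  ext y
  constructor
  · rintro ⟨z, rfl⟩; exact hpt z
  · rintro rfl
    exact ⟨IsLocalRing.closedPoint _, hpt _⟩

/-- **Support of the special fibre.** For `q′ : P′ → Spec O` (`O` local), an ideal sheaf `D′` on `P′` and the special fibre
`Z_s := V(D′) ×_{Spec O} Spec κ(O)`, the closed immersion `Z_s → V(D′) → P′` has image `supp D′ ∩ q′⁻¹{𝔪}`. [folklore] -/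
theorem range_fst_comp_subschemeι_eq {O : Type u} [CommRing O] [IsLocalRing O] {P' : Scheme.{u}}
    (q' : P' ⟶ Spec (.of O)) (D' : P'.IdealSheafData) :
    Set.range (pullback.fst (D'.subschemeι ≫ q') (Spec.map (CommRingCat.ofHom (IsLocalRing.residue O))) ≫ D'.subschemeι) =
      (D'.support : Set P') ∩ q' ⁻¹' {IsLocalRing.closedPoint O} := by
  rw [Scheme.Hom.comp_base, TopCat.coe_comp, Set.range_comp, Scheme.Pullback.range_fst, range_specMap_residue]
  ext y
  constructor
  · rintro ⟨z, hz, rfl⟩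
    refine ⟨?_, ?_⟩
    · have h := Set.mem_range_self (f := ⇑D'.subschemeι) z
      rw [Scheme.IdealSheafData.range_subschemeι] at h
      exact h
    · simpa [Scheme.Hom.comp_apply] using hz
  · rintro ⟨hy, hyq⟩
    have hy' : y ∈ Set.range ⇑D'.subschemeι := by
      rw [Scheme.IdealSheafData.range_subschemeι]; exact hy
    obtain ⟨z, rfl⟩ := hy'
    exact ⟨z, by simpa [Scheme.Hom.comp_apply] using hyq, rfl⟩

/-- **The special fibre of a smooth `O`-scheme is regular** (base change to the residue field + Stacks 056S). [folklore] -/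
theorem isRegular_specialFibre_of_smooth {O : Type u} [CommRing O] [IsLocalRing O] {Z : Scheme.{u}}
    (g : Z ⟶ Spec (.of O)) [Smooth g] :
    Literature.AlgebraicGeometry.Resolution.Scheme.IsRegular
      (pullback g (Spec.map (CommRingCat.ofHom (IsLocalRing.residue O)))) := by
  haveI : Smooth (pullback.snd g (Spec.map (CommRingCat.ofHom (IsLocalRing.residue O)))) :=
    MorphismProperty.pullback_snd (P := @Smooth) _ _ inferInstance
  intro z
  exact isRegularLocalRing_stalk_of_smooth_of_field
    (pullback.snd g (Spec.map (CommRingCat.ofHom (IsLocalRing.residue O)))) z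

/-! ## THE OBJECT -/

/-- **[OURS · L1 W4.5(b)] SMOOTH MODEL END** (strat-1's `SmoothModelEnd`, proved). Over a local ring `O`: if a closed subscheme
`V(D′) ⊆ P′` is SMOOTH over `Spec O` (`q′ : P′ → Spec O`) and its special-fibre set `supp D′ ∩ q′⁻¹{𝔪}` is `closure S′`, then the
reduced closed subscheme `V(closure S′)_red` of `P′` is regular: the special fibre of `V(D′)` is smooth over `κ(O)`, hence regular, and
a closed immersion from a regular scheme identifies it with the reduced closed subscheme on its image. [cite: StacksProject, Tag 056S] -/
theorem smoothModelEnd (O : Type u) [CommRing O] [IsLocalRing O] (P' : Scheme.{u}) (q' : P' ⟶ Spec (.of O)) (S' : Set P')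
    (D' : P'.IdealSheafData) (hsm : Smooth (D'.subschemeι ≫ q'))
    (hfib : (D'.support : Set P') ∩ q' ⁻¹' {IsLocalRing.closedPoint O} = closure S') :
    Literature.AlgebraicGeometry.Resolution.Scheme.IsRegular
      (AlgebraicGeometry.Scheme.IdealSheafData.vanishingIdeal (⟨closure S', isClosed_closure⟩ : TopologicalSpace.Closeds P')).subscheme := by
  haveI := hsm
  let ρ := Spec.map (CommRingCat.ofHom (IsLocalRing.residue O))
  let j := pullback.fst (D'.subschemeι ≫ q') ρ ≫ D'.subschemeι
  haveI : IsClosedImmersion ρ := IsClosedImmersion.spec_of_surjective _ IsLocalRing.residue_surjective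
  haveI : IsClosedImmersion (pullback.fst (D'.subschemeι ≫ q') ρ) :=
    MorphismProperty.pullback_fst (P := @IsClosedImmersion) _ _ inferInstance
  haveI : IsClosedImmersion j := inferInstance
  have hreg := isRegular_subscheme_vanishingIdeal_range j (isRegular_specialFibre_of_smooth (D'.subschemeι ≫ q'))
  have hrange : Set.range j = closure S' := (range_fst_comp_subschemeι_eq q' D').trans hfib
  have E : (⟨Set.range j, j.isClosedEmbedding.isClosed_range⟩ : Closeds P') = ⟨closure S', isClosed_closure⟩ :=
    Closeds.ext hrange
  rw [E] at hreg
  exact hreg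

end Summit.ResolutionOfSingularities.ResolutionOfSingularities.Cruxes.EquisingularLiftNat.PermFrame
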